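import Literature.MathematicalPhysics.QuantumFieldTheory.Balaban1983to89.B1Ineq351Proof
import Literature.MathematicalPhysics.QuantumFieldTheory.Balaban1983to89.B1Ineq353Proof

/-!
# `Balaban1983to89.B1Ineq322Proof` — T. Bałaban, *(Higgs)₂,₃ quantum fields in a finite volume. I. A lower bound*,
Commun. Math. Phys. **85** (1982) 603–626 [Balaban1982Higgs1]: **(3.22)** p. 616, the first-step lower bound
*"(3.7) is estimated from below by const·exp(−½⟨B,Δ^{(1),L}B⟩ − ½⟨ψ,Δ^{(1),L}(B^{(1)})ψ⟩)·(∫dA e^{−½⟨A,(C^{(0)})⁻¹A⟩})(∫dφ e^{−½⟨φ,(C^{(0)}(B^{(1)}))⁻¹φ⟩})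
·[∫dμ_{C^{(0)}}(A′)∫dμ_{C^{(0)}(B^{(1)})}(φ′)χ(A′)χ(φ′)·exp(V^{(0)} − E₀ + O(ε^κ)|T₁|)]"* — ASSEMBLED (the `k = 0` instance of the chain
(3.38) ⇒ (3.51) ⇒ (3.55)) from the two kernel-checked steps `B1Ineq351Proof.ineq351` (translations (3.10)/(3.18) under the integral +
insertion of `χ(A′)χ(φ′)`) and `B1Ineq353Proof.eq355` (the redundant `χ₀`'s dropped by (3.13)/(3.21), the Gaussian normalisations
factored, the bracket = `e^{−E₀+R}·B1Sect3Statements.integral356`); theorems only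

statement-level skeleton of published theorems with citation tags; proofs where landed; nothing here is a claim about the Yang–Mills mass gap

PDF held: `paper:balaban1982-cmp85-higgs23-i` (journal page = PDF page + 602); (3.7)–(3.13) pp. 613–614, (3.17)–(3.22) pp. 615–616 READ
AS IMAGES on the x2 renders `run/shared/lean/pub/pub-balaban/b2b-balaban-ref1/pages/1982-cmp85-higgs23-I/…-p011…p014-x2.png`.

CITATION HEADER (lean-in-tree rule).  WHAT IS REPRODUCED — SKELETON row **B1.Eq3.22** (reader r12 `lit-balaban-r12/ROWS-B1-part2.md`:
«lower bound of (3.7) by Gaussian normalisations × [∫dμ_{C^{(0)}}(A′)∫dμ_{C^{(0)}(B^{(1)})}(φ′)χ(A′)χ(φ′)exp(V^{(0)}−E₀+O(ε^κ)∣T₁∣)]; typed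
p239973 · shape (`B1Sect3Statements.integral356`)»).  Verbatim, p. 616 [PDF 14]: *"Let us come back to the integral (3.7). It is estimated
from below by const exp(−½⟨B, Δ^{(1),L}B⟩ − ½⟨ψ, Δ^{(1),L}(B^{(1)})ψ⟩)·(∫dA exp(−½⟨A, (C^{(0)})⁻¹A⟩))(∫dφ exp(−½⟨φ, (C^{(0)}(B^{(1)}))⁻¹φ⟩))
·[∫dμ_{C^{(0)}}(A′)∫dμ_{C^{(0)}(B^{(1)})}(φ′)χ(A′)χ(φ′)·exp(V^{(0)}(B^{(1)}, ψ, A′, φ′) − E₀ + O(ε^κ)|T₁|)]. (3.22)"*; the operations it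
summarises (pp. 613–616): the translation (3.10) with the splitting (3.11), the fluctuation cut-off (3.12) and the removal (3.13) of
`χ₀(A)`, the scalar translation (3.18) with (3.19), (3.20) and (3.21), the expansions (3.14)–(3.16) producing `V^{(0)}` and `O(ε^κ)|T₁|`.

THE MODEL (= the union of the models of `B1Ineq351Proof` and `B1Ineq353Proof`, at `k = 0`): field spaces `E` (↤ `A`), `F` (↤ `φ`) with
translation-invariant measures `μ`, `ν` (↤ `dA`, `dφ`); block spaces `U`, `W` (↤ `B`, `ψ`); the splittings `Split311` of the two quadratic
forms under (3.10)/(3.18), with the fluctuation forms written `½q_A(A′)` ↤ `½⟨A′,(C^{(0)})⁻¹A′⟩`, `½q_φ(φ′)` ↤ `½⟨φ′,(C^{(0)}(B^{(1)}))⁻¹φ′⟩`;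
the normalised Gaussian measures `μ_A, μ_φ` with `e^{−½q}·dμ = N·dμ_C` (`N_A` ↤ `∫dA e^{−½⟨A,(C^{(0)})⁻¹A⟩}`, `N_φ` likewise); the remaining
integrand `G ≥ 0` of (3.7), whose translate is — the displayed HYPOTHESIS `hGτ`, i.e. the exponent bookkeeping of pp. 614–616 — `χ₀(A′ +
B^{(1)})·χ₀(φ′ + ψ^{(1)})·exp(V^{(0)}(A′,φ′) − E₀ + R)` (`R` ↤ `O(ε^κ)|T₁|`); the cut-offs `χ(A′), χ(φ′) ∈ [0,1]` with the redundancy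
`χ(A′)χ(φ′) ≠ 0 ⇒ χ₀(…)χ₀(…) = 1` ((3.13)/(3.21), kernel-checked in `B1Ineq353Proof`/`B1Ineq354Proof` under their threshold conditions —
here the displayed hypothesis `hred`); the prefactor `K ≥ 0` ↤ `const`.

WHAT THIS FILE PROVES (theorems only — no `def`, no new `Prop` fact; 0 `sorry`; standard axioms):
* `bracket322` — the reshaping between the two sibling files: the cut-off translated double integral of `B1Ineq351Proof.ineq351` IS the
  (3.51)-shaped integral of `B1Ineq353Proof.eq355`, hence equals `N_A·N_φ·e^{−E₀+R}·integral356 μ_A μ_φ χ χ V^{(0)}`;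
* **`ineq322`** — (3.22): `K·e^{−q_B(B)}e^{−q_ψ(ψ)}·N_A·N_φ·e^{−E₀+R}·[∫dμ_A∫dμ_φ χ(A′)χ(φ′)exp V^{(0)}] ≤ K·∫dA e^{−q_{AB}(A,B)}∫dφ e^{−q_{φψ}(φ,ψ)}G(A,φ)`
  (= *"(3.7) ≥ const·exp(−½⟨B,Δ^{(1)}B⟩ − ½⟨ψ,Δ^{(1)}(B^{(1)})ψ⟩)(∫dA e^{−½⟨A,C⁻¹A⟩})(∫dφ …)[…]"*).
HONEST SCOPE.  As in the two siblings: the splitting identities, the form of the translated integrand (`hGτ`) and the redundancy of the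
`χ₀`'s (`hred`) are displayed hypotheses with their printed justifications; kernel-checked is the assembly of the printed operations.
Unit `lit-balaban-p14` gen 3 (Phase-2 proof seat p14, literature-prover-lit-balaban-p14-g3-0), HOME `run/shared/lean/pub/lit-balaban/`
(seat log `lit-balaban-p14/STATUS.md`).
-/

namespace Literature.MathematicalPhysics.QuantumFieldTheory.Balaban1983to89.B1Ineq322Proof

open Literature.MathematicalPhysics.QuantumFieldTheory.Balaban1983to89
open B1Sect3Statements B1Ineq351Proof B1Ineq353Proof MeasureTheory

variable {E U F W : Type*} [AddCommGroup E] [Module ℝ E] [AddCommGroup U] [Module ℝ U]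
  [AddCommGroup F] [Module ℝ F] [AddCommGroup W] [Module ℝ W]
  [MeasurableSpace E] [MeasurableAdd E] (μ : Measure E) [μ.IsAddLeftInvariant]
  [MeasurableSpace F] [MeasurableAdd F] (ν : Measure F) [ν.IsAddLeftInvariant]

omit [AddCommGroup E] [Module ℝ E] [AddCommGroup F] [Module ℝ F] [MeasurableAdd E] [μ.IsAddLeftInvariant] [MeasurableAdd F]
  [ν.IsAddLeftInvariant] in
/-- **The bracket of (3.22)**: after the translations, with the translated integrand of the printed form `χ₀(A′ + B^{(1)})χ₀(φ′ + ψ^{(1)})·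
exp(V^{(0)} − E₀ + R)` (`hGτ`) and the redundancy (3.13)/(3.21) of the `χ₀`'s on the support of `χ(A′)χ(φ′)` (`hred`), the cut-off double
integral equals `N_A·N_φ·e^{−E₀+R}·∫dμ_{C^{(0)}}(A′)∫dμ_{C^{(0)}(B^{(1)})}(φ′)χ(A′)χ(φ′)exp V^{(0)}` — by `B1Ineq353Proof.eq355`.
[cite: Balaban1982Higgs1, (3.22) p.616] -/
theorem bracket322 (μA : Measure E) (μφ : Measure F) {qA : E → ℝ} {qφ : F → ℝ} {NA Nφ : ℝ}
    (hqA : Measurable qA) (hqφ : Measurable qφ) (hNA : 0 ≤ NA) (hNφ : 0 ≤ Nφ)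
    (hμA : μ.withDensity (fun a => ENNReal.ofReal (Real.exp (-(qA a) / 2))) = ENNReal.ofReal NA • μA)
    (hμφ : ν.withDensity (fun f => ENNReal.ofReal (Real.exp (-(qφ f) / 2))) = ENNReal.ofReal Nφ • μφ)
    (τA : E → E) (τφ : F → F) (G : E → F → ℝ) (χkA χA : E → ℝ) (χkφ V : E → F → ℝ) (χφ : F → ℝ) (E₀ R : ℝ)
    (hGτ : ∀ A' φ', G (τA A') (τφ φ') = χkA A' * χkφ A' φ' * Real.exp (V A' φ' - E₀ + R))
    (hred : ∀ A' φ', χA A' ≠ 0 → χφ φ' ≠ 0 → χkA A' * χkφ A' φ' = 1) :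
    ∫ A', χA A' * (Real.exp (-(qA A' / 2)) * ∫ φ', χφ φ' * (Real.exp (-(qφ φ' / 2)) * G (τA A') (τφ φ')) ∂ν) ∂μ
      = NA * Nφ * (Real.exp (-E₀ + R) * integral356 μA μφ χA χφ V) := by
  have hreshape : ∀ A', χA A' * (Real.exp (-(qA A' / 2)) * ∫ φ', χφ φ' * (Real.exp (-(qφ φ' / 2)) * G (τA A') (τφ φ')) ∂ν)
      = ∫ φ', χkA A' * χkφ A' φ' * (χA A' * χφ φ')
          * Real.exp (-(qA A') / 2 - qφ φ' / 2 + (V A' φ' - E₀ + R)) ∂ν := by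
    intro A'
    rw [← mul_assoc, ← integral_const_mul]
    refine integral_congr_ae (Filter.Eventually.of_forall fun φ' => ?_)
    show χA A' * Real.exp (-(qA A' / 2)) * (χφ φ' * (Real.exp (-(qφ φ' / 2)) * G (τA A') (τφ φ')))
      = χkA A' * χkφ A' φ' * (χA A' * χφ φ') * Real.exp (-(qA A') / 2 - qφ φ' / 2 + (V A' φ' - E₀ + R))
    rw [hGτ A' φ', show -(qA A') / 2 - qφ φ' / 2 + (V A' φ' - E₀ + R)
        = (-(qA A' / 2)) + ((-(qφ φ' / 2)) + (V A' φ' - E₀ + R)) by ring,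
      Real.exp_add (-(qA A' / 2)) ((-(qφ φ' / 2)) + (V A' φ' - E₀ + R)),
      Real.exp_add (-(qφ φ' / 2)) (V A' φ' - E₀ + R)]
    ring
  rw [integral_congr_ae (Filter.Eventually.of_forall hreshape)]
  exact eq355 μ μA ν μφ hqA hqφ hNA hNφ hμA hμφ χkA χA χkφ V χφ E₀ R hred

/-- **(3.22) p. 616** — *"(3.7) is estimated from below by const·exp(−½⟨B,Δ^{(1),L}B⟩ − ½⟨ψ,Δ^{(1),L}(B^{(1)})ψ⟩)·(∫dA e^{−½⟨A,(C^{(0)})⁻¹A⟩})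
(∫dφ e^{−½⟨φ,(C^{(0)}(B^{(1)}))⁻¹φ⟩})·[∫dμ_{C^{(0)}}(A′)∫dμ_{C^{(0)}(B^{(1)})}(φ′)χ(A′)χ(φ′)exp(V^{(0)} − E₀ + O(ε^κ)|T₁|)]"*: the `k = 0` chain
`B1Ineq351Proof.ineq351` (translations (3.10)/(3.18) with their splittings `Split311`, insertion of `χ(A′)χ(φ′) ∈ [0,1]` against `G ≥ 0`) then
`bracket322`.  `K` ↤ const, `e^{−q_B(B)}e^{−q_ψ(ψ)}` ↤ the block-field Gaussians, `N_A, N_φ` ↤ the two normalisation integrals, `R` ↤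
`O(ε^κ)|T₁|`. [cite: Balaban1982Higgs1, (3.22) p.616] -/
theorem ineq322 {cA : ℝ} {CA : E →ₗ[ℝ] E} {QsA : U →ₗ[ℝ] E} {qAB : E → U → ℝ} {qB : U → ℝ} {qA : E → ℝ}
    (hA : Split311 cA CA QsA qAB qB (fun A' => qA A' / 2)) {cφ : ℝ} {Cφ : F →ₗ[ℝ] F} {Qsφ : W →ₗ[ℝ] F}
    {qφψ : F → W → ℝ} {qψ : W → ℝ} {qφ : F → ℝ} (hφ : Split311 cφ Cφ Qsφ qφψ qψ (fun φ' => qφ φ' / 2)) (B : U) (ψ : W)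
    {K : ℝ} (hK : 0 ≤ K) {G : E → F → ℝ} (hG : ∀ A φ, 0 ≤ G A φ) {χA : E → ℝ} (hχA0 : ∀ A, 0 ≤ χA A)
    (hχA1 : ∀ A, χA A ≤ 1) {χφ : F → ℝ} (hχφ0 : ∀ φ, 0 ≤ χφ φ) (hχφ1 : ∀ φ, χφ φ ≤ 1)
    (hintφ : ∀ A', Integrable (fun φ' => Real.exp (-(qφ φ' / 2))
      * G (transl310 cA CA QsA A' B) (transl310 cφ Cφ Qsφ φ' ψ)) ν)
    (hintA : Integrable (fun A' => Real.exp (-(qA A' / 2)) * ∫ φ', Real.exp (-(qφ φ' / 2))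
      * G (transl310 cA CA QsA A' B) (transl310 cφ Cφ Qsφ φ' ψ) ∂ν) μ)
    (μA : Measure E) (μφ : Measure F) {NA Nφ : ℝ} (hqA : Measurable qA) (hqφ : Measurable qφ) (hNA : 0 ≤ NA)
    (hNφ : 0 ≤ Nφ) (hμA : μ.withDensity (fun a => ENNReal.ofReal (Real.exp (-(qA a) / 2))) = ENNReal.ofReal NA • μA)
    (hμφ : ν.withDensity (fun f => ENNReal.ofReal (Real.exp (-(qφ f) / 2))) = ENNReal.ofReal Nφ • μφ)
    (χkA : E → ℝ) (χkφ V : E → F → ℝ) (E₀ R : ℝ)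
    (hGτ : ∀ A' φ', G (transl310 cA CA QsA A' B) (transl310 cφ Cφ Qsφ φ' ψ)
      = χkA A' * χkφ A' φ' * Real.exp (V A' φ' - E₀ + R))
    (hred : ∀ A' φ', χA A' ≠ 0 → χφ φ' ≠ 0 → χkA A' * χkφ A' φ' = 1) :
    K * (Real.exp (-qB B) * Real.exp (-qψ ψ) * (NA * Nφ * (Real.exp (-E₀ + R) * integral356 μA μφ χA χφ V)))
      ≤ K * ∫ A, Real.exp (-qAB A B) * ∫ φ, Real.exp (-qφψ φ ψ) * G A φ ∂ν ∂μ := by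
  have h351 := ineq351 μ ν hA hφ B ψ hK hG hχA0 hχA1 hχφ0 hχφ1 hintφ hintA
  rw [← bracket322 μ ν μA μφ hqA hqφ hNA hNφ hμA hμφ _ _ G χkA χA χkφ V χφ E₀ R hGτ hred]
  exact h351

end Literature.MathematicalPhysics.QuantumFieldTheory.Balaban1983to89.B1Ineq322Proof
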